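import Mathlib
import Summits.CriticalPhenomena.CardyFormulaZ2.Theorems.CardyMagicRigidityNestingRigidityTowerMomentUpperPatterns
import Summits.CriticalPhenomena.CardyFormulaZ2.Theorems.CardyMagicRigidityNestingRigidityBigLoopsExpMomentZ2
import HarnessLib

/-!
# Crux `NestingRigidity`, line `positive-cone-weight-doubling`: POISSONIAN pattern summation —
# exponential moments of a loop count from joint geometric tails, with the rate of a sum of
# rare independent indicators (collar statistic, helper K `uvCollar_expMoment_latticeEnsembles`)

Crux `Summit.CriticalPhenomena.CardyFormulaZ2.Theses.CardyMagicRigidity.NestingRigidity`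
(stmt-CriticalPhenomena-4835), line `positive-cone-weight-doubling`, registered helper K
`uvCollar_expMoment_latticeEnsembles` (all-order exponential moments of the collar statistic of
the cone cloud).  The thin-cell / one-BK-product summations already in the tree
(`BigLoopsExp.integral_exp_le_of_jointTails`: `E e^{tN} ≤ 2 · 2^B`;
`TowerMomentUpper.integral_pow_le_two_pow`: `E w^N ≤ 2^B`) pay a factor `2` PER CELL whatever the
single-cell crossing probability `p` is.  The collar statistic is a sum over dyadic scales of
(small weight) × (number of loops crossing a thin collar at that scale), with `≍ 2^j` cells at scale
`j`: there the correct, POISSONIAN, rate `log E e^{λ N} = O((e^{2λ} − 1) · p · B)` — small in `λ`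
AND in `p` — is needed.  This file proves it, on an arbitrary probability space (no lattice input,
no cited fact, no definition):

* §1 the telescoping weights `c_m = e^{μ m} − e^{μ(m−1)}` (`c_0 = 1`): `Σ_{m ≤ f} c_m = e^{μ f}` and
  `Σ_{m ≤ M} c_m p^m ≤ exp(2 (e^μ − 1) p)` for `e^μ p ≤ 1/2`;
* §2 (`UVCollar.integral_exp_le_of_poissonTails`) if almost every sample admits two patterns
  `f₁ f₀ : Fin B → ℕ` (`≤ M`) with `N ≤ Σ f₁ + Σ f₀` such that `ω ∈ EV₁ g` for EVERY `g ≤ f₁` and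
  `ω ∈ EV₀ g` for every `g ≤ f₀` (the joint disjoint occurrence of `g i` crossings in cell `i` is
  monotone in `g`), and the measurable pattern events have `P(EV g) ≤ Π_i p^{g i}`, then
  `E e^{λ N} ≤ exp(2 (e^{2λ} − 1) p B)` for `λ ≥ 0`, `e^{2λ} p ≤ 1/2`:
  `e^{2λ Σ_i f i} = Π_i Σ_{m ≤ f i} c_m = Σ_{g ≤ f} Π_i c_{g i} ≤ Σ_g (Π_i c_{g i}) 1_{EV g}` and
  `Σ_g (Π_i c_{g i}) P(EV g) ≤ Π_i Σ_m c_m p^m`;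
* §3 the same on `E.P`, `E ∈ latticeEnsembles` (registered anchor
  `expMoment_le_of_poissonTails_latticeEnsembles`).
-/

noncomputable section

open MeasureTheory Set Filter Metric
open scoped Real Topology BigOperators

namespace Summit.CriticalPhenomena.CardyFormulaZ2.Cruxes.NestingRigidity.PositiveConeWeightDoubling

open Summit.CriticalPhenomena.CardyFormulaZ2.Cruxes.NestingRigidity.RingCloudTomography

namespace UVCollar

/-! ## §1 The telescoping weights -/

/-- The telescoping weights of the Poissonian summation: `c q 0 = 1`, `c q (m+1) = q^{m+1} − q^m`. -/
theorem telescope_sum_range (q : ℝ) (f : ℕ) :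
    ∑ m ∈ Finset.range (f + 1), (if m = 0 then (1 : ℝ) else q ^ m - q ^ (m - 1)) = q ^ f := by
  induction f with
  | zero => simp
  | succ f ih =>
    rw [Finset.sum_range_succ, ih]
    simp only [Nat.succ_ne_zero, ↓reduceIte, Nat.add_sub_cancel]
    ring

/-- The weights are nonnegative for `q ≥ 1`. -/
theorem telescope_nonneg {q : ℝ} (hq : 1 ≤ q) (m : ℕ) :
    0 ≤ (if m = 0 then (1 : ℝ) else q ^ m - q ^ (m - 1)) := by
  split_ifs with hm
  · exact zero_le_one
  · obtain ⟨k, rfl⟩ := Nat.exists_eq_succ_of_ne_zero hm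
    rw [Nat.succ_sub_one, pow_succ]
    nlinarith [pow_nonneg (zero_le_one.trans hq) k]

/-- **The single-cell factor**: `Σ_{m ≤ M} c_m p^m ≤ exp(2 (q − 1) p)` for `q ≥ 1`, `p ≥ 0`,
`q p ≤ 1/2` (`= 1 + (q − 1) p Σ_{m < M} (q p)^m`). -/
theorem sum_telescope_mul_pow_le {q p : ℝ} (hq : 1 ≤ q) (hp : 0 ≤ p) (hqp : q * p ≤ 1 / 2) (M : ℕ) :
    ∑ m ∈ Finset.range (M + 1), (if m = 0 then (1 : ℝ) else q ^ m - q ^ (m - 1)) * p ^ m ≤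
      Real.exp (2 * (q - 1) * p) := by
  rw [Finset.sum_range_succ']
  simp only [Nat.succ_ne_zero, ↓reduceIte, Nat.add_sub_cancel, pow_zero, mul_one]
  have hgeom := BigLoopsExp.geom_sum_range_le_two (mul_nonneg (zero_le_one.trans hq) hp) hqp M
  have hterm : ∀ m ∈ Finset.range M, (q ^ (m + 1) - q ^ m) * p ^ (m + 1) = (q - 1) * p * (q * p) ^ m := by
    intro m _
    rw [mul_pow]; ring
  rw [Finset.sum_congr rfl hterm, ← Finset.mul_sum]
  have h1 : 0 ≤ (q - 1) * p := mul_nonneg (by linarith) hp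
  calc (q - 1) * p * ∑ m ∈ Finset.range M, (q * p) ^ m + 1 ≤ (q - 1) * p * 2 + 1 := by
        nlinarith [mul_le_mul_of_nonneg_left hgeom h1]
    _ ≤ Real.exp (2 * (q - 1) * p) := by
        have := Real.add_one_le_exp (2 * (q - 1) * p)
        linarith

/-! ## §2 The Poissonian pattern summation -/

variable {Ω : Type*} [MeasurableSpace Ω]

omit [MeasurableSpace Ω] in
/-- **One pattern is dominated by the weighted pattern majorant.**  With `q ≥ 1` and the weights
`c_m` of §1: if `ω ∈ EV g` for every `g ≤ f` (`f ≤ M` pointwise), then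
`q ^ (Σ_i f i) ≤ Σ_{g ≤ M} (Π_i c_{g i}) 1_{EV g}(ω)`. -/
theorem pow_sum_le_patternSum {B M : ℕ} (EV : (Fin B → ℕ) → Set Ω) {q : ℝ} (hq : 1 ≤ q)
    {f : Fin B → ℕ} (hfM : ∀ i, f i ≤ M) {ω : Ω} (hω : ∀ g : Fin B → ℕ, (∀ i, g i ≤ f i) → ω ∈ EV g) :
    q ^ (∑ i, f i) ≤ ∑ g ∈ Fintype.piFinset (fun _ : Fin B ↦ Finset.range (M + 1)),
      (∏ i, (if g i = 0 then (1 : ℝ) else q ^ (g i) - q ^ (g i - 1))) * (EV g).indicator (fun _ ↦ (1 : ℝ)) ω := by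
  classical
  -- `q^{Σ f} = Π_i Σ_{m ≤ f i} c_m = Σ_{g ≤ f} Π_i c_{g i}`
  have key := Finset.prod_univ_sum (fun i : Fin B ↦ Finset.range (f i + 1))
    (fun _ m ↦ (if m = 0 then (1 : ℝ) else q ^ m - q ^ (m - 1)))
  have hexp : q ^ (∑ i, f i) = ∑ g ∈ Fintype.piFinset (fun i : Fin B ↦ Finset.range (f i + 1)),
      ∏ i, (if g i = 0 then (1 : ℝ) else q ^ (g i) - q ^ (g i - 1)) := by
    rw [← Finset.prod_pow_eq_pow_sum, ← key]
    exact Finset.prod_congr rfl fun i _ ↦ (telescope_sum_range q (f i)).symm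
  rw [hexp]
  have hsub : Fintype.piFinset (fun i : Fin B ↦ Finset.range (f i + 1)) ⊆
      Fintype.piFinset (fun _ : Fin B ↦ Finset.range (M + 1)) :=
    Fintype.piFinset_subset _ _ fun i ↦ Finset.range_subset_range.2 (Nat.succ_le_succ (hfM i))
  calc ∑ g ∈ Fintype.piFinset (fun i : Fin B ↦ Finset.range (f i + 1)),
        ∏ i, (if g i = 0 then (1 : ℝ) else q ^ (g i) - q ^ (g i - 1))
      = ∑ g ∈ Fintype.piFinset (fun i : Fin B ↦ Finset.range (f i + 1)),
          (∏ i, (if g i = 0 then (1 : ℝ) else q ^ (g i) - q ^ (g i - 1))) *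
            (EV g).indicator (fun _ ↦ (1 : ℝ)) ω := by
        refine Finset.sum_congr rfl fun g hg ↦ ?_
        have hgf : ∀ i, g i ≤ f i := fun i ↦
          Nat.lt_succ_iff.1 (Finset.mem_range.1 (Fintype.mem_piFinset.1 hg i))
        rw [Set.indicator_of_mem (hω g hgf), mul_one]
    _ ≤ _ := Finset.sum_le_sum_of_subset_of_nonneg hsub fun g _ _ ↦
        mul_nonneg (Finset.prod_nonneg fun i _ ↦ telescope_nonneg hq _)
          (Set.indicator_nonneg (fun _ _ ↦ zero_le_one) _)

/-- **The weighted pattern majorant has integral `≤ exp(2 (q − 1) p B)`** when the measurable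
pattern events satisfy `P(EV g) ≤ Π_i p^{g i}`, `q ≥ 1`, `p ≥ 0`, `q p ≤ 1/2`. -/
theorem integral_patternSum_le (P : Measure Ω) [IsFiniteMeasure P] {B M : ℕ}
    (EV : (Fin B → ℕ) → Set Ω) (hm : ∀ g, MeasurableSet (EV g)) {q p : ℝ} (hq : 1 ≤ q)
    (hp : 0 ≤ p) (hqp : q * p ≤ 1 / 2) (hP : ∀ g, P.real (EV g) ≤ ∏ i, p ^ (g i)) :
    Integrable (fun ω ↦ ∑ g ∈ Fintype.piFinset (fun _ : Fin B ↦ Finset.range (M + 1)),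
      (∏ i, (if g i = 0 then (1 : ℝ) else q ^ (g i) - q ^ (g i - 1))) *
        (EV g).indicator (fun _ ↦ (1 : ℝ)) ω) P ∧
    ∫ ω, ∑ g ∈ Fintype.piFinset (fun _ : Fin B ↦ Finset.range (M + 1)),
      (∏ i, (if g i = 0 then (1 : ℝ) else q ^ (g i) - q ^ (g i - 1))) *
        (EV g).indicator (fun _ ↦ (1 : ℝ)) ω ∂P ≤ Real.exp (2 * (q - 1) * p * B) := by
  classical
  have hint : ∀ g : Fin B → ℕ, Integrable (fun ω ↦
      (∏ i, (if g i = 0 then (1 : ℝ) else q ^ (g i) - q ^ (g i - 1))) *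
        (EV g).indicator (fun _ ↦ (1 : ℝ)) ω) P :=
    fun g ↦ ((integrable_const _).indicator (hm g)).const_mul _
  refine ⟨integrable_finsetSum _ fun g _ ↦ hint g, ?_⟩
  rw [integral_finsetSum _ fun g _ ↦ hint g]
  calc ∑ g ∈ Fintype.piFinset (fun _ : Fin B ↦ Finset.range (M + 1)),
        ∫ ω, (∏ i, (if g i = 0 then (1 : ℝ) else q ^ (g i) - q ^ (g i - 1))) *
          (EV g).indicator (fun _ ↦ (1 : ℝ)) ω ∂P
      = ∑ g ∈ Fintype.piFinset (fun _ : Fin B ↦ Finset.range (M + 1)),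
          (∏ i, (if g i = 0 then (1 : ℝ) else q ^ (g i) - q ^ (g i - 1))) * P.real (EV g) := by
        refine Finset.sum_congr rfl fun g _ ↦ ?_
        rw [integral_const_mul, integral_indicator_const _ (hm g), smul_eq_mul, mul_one]
    _ ≤ ∑ g ∈ Fintype.piFinset (fun _ : Fin B ↦ Finset.range (M + 1)),
          ∏ i, (if g i = 0 then (1 : ℝ) else q ^ (g i) - q ^ (g i - 1)) * p ^ (g i) := by
        refine Finset.sum_le_sum fun g _ ↦ ?_
        rw [Finset.prod_mul_distrib]
        exact mul_le_mul_of_nonneg_left (hP g) (Finset.prod_nonneg fun i _ ↦ telescope_nonneg hq _)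
    _ = ∏ _i : Fin B, ∑ m ∈ Finset.range (M + 1),
          (if m = 0 then (1 : ℝ) else q ^ m - q ^ (m - 1)) * p ^ m :=
        (Finset.prod_univ_sum (fun _ : Fin B ↦ Finset.range (M + 1))
          (fun _ m ↦ (if m = 0 then (1 : ℝ) else q ^ m - q ^ (m - 1)) * p ^ m)).symm
    _ ≤ ∏ _i : Fin B, Real.exp (2 * (q - 1) * p) :=
        Finset.prod_le_prod (fun i _ ↦ Finset.sum_nonneg fun m _ ↦
          mul_nonneg (telescope_nonneg hq _) (pow_nonneg hp _))
          fun i _ ↦ sum_telescope_mul_pow_le hq hp hqp M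
    _ = Real.exp (2 * (q - 1) * p * B) := by
        rw [Finset.prod_const, Finset.card_univ, Fintype.card_fin, ← Real.exp_nat_mul]; ring_nf

/-- **Exponential moments from joint geometric tails, Poissonian form.**  On a probability space
let `N : Ω → ℕ` satisfy, almost surely, `N ≤ Σ_i f₁ i + Σ_i f₀ i` for two patterns
`f₁ f₀ : Fin B → ℕ` bounded by `M` such that `ω ∈ EV₁ g` for EVERY `g ≤ f₁` and `ω ∈ EV₀ g` for
every `g ≤ f₀`, where the measurable pattern events have the joint geometric tails
`P(EV₁ g), P(EV₀ g) ≤ Π_i p^{g i}`.  If `0 ≤ λ`, `0 ≤ p` and `e^{2λ} p ≤ 1/2`, then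
`∫ e^{λ N} ≤ exp(2 (e^{2λ} − 1) p B)` — the rate of `B` independent Poisson-like cells of
intensity `p`, small both in `λ` and in `p` (compare `BigLoopsExp.integral_exp_le_of_jointTails`:
`≤ 2 · 2^B`).  No measurability of `N` is needed. -/
theorem integral_exp_le_of_poissonTails (P : Measure Ω) [IsProbabilityMeasure P] {l p : ℝ}
    (hl : 0 ≤ l) (hp : 0 ≤ p) (hq : Real.exp (2 * l) * p ≤ 1 / 2) {B M : ℕ}
    (EV₁ EV₀ : (Fin B → ℕ) → Set Ω) (hm₁ : ∀ g, MeasurableSet (EV₁ g))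
    (hm₀ : ∀ g, MeasurableSet (EV₀ g)) (hP₁ : ∀ g, P.real (EV₁ g) ≤ ∏ i, p ^ (g i))
    (hP₀ : ∀ g, P.real (EV₀ g) ≤ ∏ i, p ^ (g i)) (N : Ω → ℕ)
    (hdom : ∀ᵐ ω ∂P, ∃ f₁ f₀ : Fin B → ℕ, (∀ i, f₁ i ≤ M) ∧ (∀ i, f₀ i ≤ M) ∧
      (∀ g : Fin B → ℕ, (∀ i, g i ≤ f₁ i) → ω ∈ EV₁ g) ∧
      (∀ g : Fin B → ℕ, (∀ i, g i ≤ f₀ i) → ω ∈ EV₀ g) ∧ N ω ≤ ∑ i, f₁ i + ∑ i, f₀ i) :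
    ∫ ω, Real.exp (l * N ω) ∂P ≤ Real.exp (2 * (Real.exp (2 * l) - 1) * p * B) := by
  classical
  set q : ℝ := Real.exp (2 * l) with hq_def
  have hq1 : 1 ≤ q := Real.one_le_exp (by positivity)
  set G : ((Fin B → ℕ) → Set Ω) → Ω → ℝ := fun EV ω ↦
    ∑ g ∈ Fintype.piFinset (fun _ : Fin B ↦ Finset.range (M + 1)),
      (∏ i, (if g i = 0 then (1 : ℝ) else q ^ (g i) - q ^ (g i - 1))) *
        (EV g).indicator (fun _ ↦ (1 : ℝ)) ω with hG
  obtain ⟨hint₁, hI₁⟩ := integral_patternSum_le P EV₁ hm₁ hq1 hp hq hP₁ (M := M)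
  obtain ⟨hint₀, hI₀⟩ := integral_patternSum_le P EV₀ hm₀ hq1 hp hq hP₀ (M := M)
  have hv : Real.exp l ^ 2 = q := by rw [hq_def, ← Real.exp_nat_mul]; norm_num
  calc ∫ ω, Real.exp (l * N ω) ∂P ≤ ∫ ω, (G EV₁ ω + G EV₀ ω) / 2 ∂P := by
        refine integral_mono_of_nonneg (Eventually.of_forall fun ω ↦ (Real.exp_pos _).le)
          ((hint₁.add hint₀).div_const 2) ?_
        filter_upwards [hdom] with ω ⟨f₁, f₀, hf₁, hf₀, h₁, h₀, hNle⟩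
        have hNle' : (N ω : ℝ) ≤ ((∑ i, f₁ i + ∑ i, f₀ i : ℕ) : ℝ) := by exact_mod_cast hNle
        calc Real.exp (l * N ω) ≤ Real.exp (l * ((∑ i, f₁ i + ∑ i, f₀ i : ℕ) : ℝ)) :=
              Real.exp_le_exp.2 (mul_le_mul_of_nonneg_left hNle' hl)
          _ = Real.exp l ^ (∑ i, f₁ i + ∑ i, f₀ i) := by rw [← Real.exp_nat_mul, mul_comm]
          _ = Real.exp l ^ (∑ i, f₁ i) * Real.exp l ^ (∑ i, f₀ i) := pow_add _ _ _
          _ ≤ ((Real.exp l ^ 2) ^ (∑ i, f₁ i) + (Real.exp l ^ 2) ^ (∑ i, f₀ i)) / 2 :=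
              TowerMomentUpper.pow_mul_pow_le_half_add _ _ _
          _ ≤ (G EV₁ ω + G EV₀ ω) / 2 := by
              rw [hv]
              gcongr
              · exact pow_sum_le_patternSum EV₁ hq1 hf₁ h₁
              · exact pow_sum_le_patternSum EV₀ hq1 hf₀ h₀
    _ = ((∫ ω, G EV₁ ω ∂P) + ∫ ω, G EV₀ ω ∂P) / 2 := by rw [integral_div, integral_add hint₁ hint₀]
    _ ≤ (Real.exp (2 * (q - 1) * p * B) + Real.exp (2 * (q - 1) * p * B)) / 2 := by gcongr
    _ = Real.exp (2 * (Real.exp (2 * l) - 1) * p * B) := by ring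

end UVCollar

/-! ## §3 On the lattice ensembles (registered anchor) -/

/-- **Poissonian pattern summation on both lattice ensembles** (registered helper toward K
`uvCollar_expMoment_latticeEnsembles`, line `positive-cone-weight-doubling`).  For
`E ∈ latticeEnsembles` and a loop count `N` on `E.Ω`: if almost every sample admits two patterns
`f₁ f₀ : Fin B → ℕ` (`≤ M`) with `N ≤ Σ f₁ + Σ f₀`, `ω ∈ EV₁ g` for every `g ≤ f₁` and `ω ∈ EV₀ g`
for every `g ≤ f₀` (joint disjoint occurrences are monotone in the multiplicities), the measurable
pattern events having the joint geometric tails `P(EV g) ≤ Π_i p^{g i}` of ONE BK product, then for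
`0 ≤ λ`, `e^{2λ} p ≤ 1/2`: `E_δ e^{λ N} ≤ exp(2 (e^{2λ} − 1) p B)` — Poissonian in the number of
cells `B` and the cell intensity `p`, the form that sums over the dyadic scales of the collar. -/
theorem expMoment_le_of_poissonTails_latticeEnsembles : ∀ E ∈ latticeEnsembles, ∀ (B M : ℕ) (EV₁ EV₀ : (Fin B → ℕ) → Set E.Ω) (N : E.Ω → ℕ) (l p : ℝ), 0 ≤ l → 0 ≤ p → Real.exp (2 * l) * p ≤ 1 / 2 → (∀ g, MeasurableSet (EV₁ g)) → (∀ g, MeasurableSet (EV₀ g)) → (∀ g, E.P.real (EV₁ g) ≤ ∏ i, p ^ (g i)) → (∀ g, E.P.real (EV₀ g) ≤ ∏ i, p ^ (g i)) → (∀ᵐ ω ∂E.P, ∃ f₁ f₀ : Fin B → ℕ, (∀ i, f₁ i ≤ M) ∧ (∀ i, f₀ i ≤ M) ∧ (∀ g : Fin B → ℕ, (∀ i, g i ≤ f₁ i) → ω ∈ EV₁ g) ∧ (∀ g : Fin B → ℕ, (∀ i, g i ≤ f₀ i) → ω ∈ EV₀ g) ∧ N ω ≤ ∑ i, f₁ i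 + ∑ i, f₀ i) → ∫ ω, Real.exp (l * N ω) ∂E.P ≤ Real.exp (2 * (Real.exp (2 * l) - 1) * p * B) := by
  intro E hE B M EV₁ EV₀ N l p hl hp hq hm₁ hm₀ hP₁ hP₀ hdom
  haveI := isProbabilityMeasure_of_mem hE
  exact UVCollar.integral_exp_le_of_poissonTails E.P hl hp hq EV₁ EV₀ hm₁ hm₀ hP₁ hP₀ N hdom

end Summit.CriticalPhenomena.CardyFormulaZ2.Cruxes.NestingRigidity.PositiveConeWeightDoubling

end
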